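import Summits.RiemannHypothesis.RiemannHypothesis.Theorems.CCRouteAdapters
import Literature.NumberTheory.ConnesConsani2021.SpectralCertificate
import Literature.NumberTheory.ConnesConsani2021.EpsSlopeEnclosure
import HarnessLib

/-!
# Route «ConnesConsaniSemilocal», crux K3 `WindowSpectralBound` (stmt-RiemannHypothesis-19306) — closer MODULO (E-a) ONLY

RH-FREE bookkeeping of an RH-free corpus statement (cell `rh-crit/cc`, seat `rh-crit-cc-iso` g4; chain of record cc-lead
R57 (3)/R76/R91/R93 (3), BOUNDARY LEDGER «K3 ⇐ {(E-a)}»).  K3 says: for every `C²` extension `G` of the archimedean density,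
some `a₀ ∈ [0, 0.0635]` makes `⟨ξ|(1 − 𝐊_I)ξ⟩ + a₀|⟨η₀|ξ⟩|² ≥ 0` on `L²(I)`, `I = [−½log 2, ½log 2]` (Connes–Consani 2021 §6,
Lemmas 6.3/6.4/6.8/6.9, Thm. 6.11).  The tree's kernel-checked certificate `SpectralCert.windowSpectralBound_of_L1` (t7,
`SpectralCertCheck.lean` p427011) proves it from ONE analytic input per `G`, the `L¹` bound
`SpectralCert.AnalyticInputValid G` (‖τ_c − ϖ_G‖_{L¹[−log 2, log 2]} ≤ 1/400).  t7's named fact `CC2021_section6_enclosures`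
(p428484, NUMERICAL-CERTIFIED-EXTERNAL) is the conjunction (E-a) ∧ (E-b); since (E-b) is now the in-kernel theorem
`SlopeCert.epsSlope_enclosure_holds` (t15 g2, p433694), the fact is EQUIVALENT to its (E-a) conjunct alone
(`section6_enclosures_iff_analyticInput`), and K3 follows from (E-a) alone (`windowSpectralBound_of_analyticInput`) — the
shape t7 g2's Tier 1 frame `ArchKernelL1Frame.lean` (`analyticInputValid_of_certificate`) will conclude, so the K3 closer is
ONE application the hour (E-a) is a theorem.  `conditional-result`s for the gate (helper); the item stays open ((β) accounting,
director-rh 06:15:18Z; the certificate half of (E-a) is deferred by ruling).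
WHAT THIS IS NOT: any claim about RH — K3 is an RH-FREE binder of a route whose leaf (CC2021 eq. (4)) is RH-FREE and not
RH-detecting; the RH-EQUIVALENT residual `IsolatedCC` is untouched.  Nothing here bears on the truth of RH.
-/

-- `Summit.RiemannHypothesis.RiemannHypothesis.…` duplicates `RiemannHypothesis` BY DESIGN (D-0017).
set_option linter.dupNamespace false

noncomputable section

namespace Summit.RiemannHypothesis.RiemannHypothesis.Theorems.CCRouteAdapters

open Literature.NumberTheory.LFunctions Literature.NumberTheory.ConnesConsani2021

/-- RH-FREE. **K3 `WindowSpectralBound` from the analytic input (E-a) ALONE** (route «ConnesConsaniSemilocal», item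
stmt-RiemannHypothesis-19306): for every `C²` archimedean density, the `L¹` bound `SpectralCert.AnalyticInputValid G` feeds
t7's kernel-checked certificate `SpectralCert.windowSpectralBound_of_L1` (a₀ = 127/2000), and the K3 transport
`windowSpectralBound_iff` gives the route item. [cite: ConnesConsani2021, §6.4 Fact 6.1 + Lemma 6.3 p. 24; §6.7 Lemma 6.10 / Thm. 6.11 p. 28] -/
theorem windowSpectralBound_of_analyticInput
    (hEa : ∀ G : ℝ → ℂ, ContDiff ℝ 2 G → IsArchDensity G → SpectralCert.AnalyticInputValid G) :
    Summit.RiemannHypothesis.RiemannHypothesis.Theses.ConnesConsaniSemilocal.WindowSpectralBound :=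
  windowSpectralBound_iff.mpr fun G hG hd => SpectralCert.windowSpectralBound_of_L1 G hG (hEa G hG hd)

/-- RH-FREE. With (E-b) a kernel theorem (`SlopeCert.epsSlope_enclosure_holds`), t7's named fact `CC2021_section6_enclosures`
IS its (E-a) conjunct: the frozen numerical boundary of K3 is exactly (E-a). [cite: ConnesConsani2021, §6.4 Fact 6.1 + Lemma 6.3 p. 24; §5 Lemma 5.4 p. 20] -/
theorem section6_enclosures_iff_analyticInput :
    CC2021_section6_enclosures ↔
      ∀ G : ℝ → ℂ, ContDiff ℝ 2 G → IsArchDensity G → SpectralCert.AnalyticInputValid G :=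
  ⟨fun h => h.1, fun h => ⟨h, SlopeCert.epsSlope_enclosure_holds⟩⟩

end Summit.RiemannHypothesis.RiemannHypothesis.Theorems.CCRouteAdapters

end
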